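import Summits.QuantumFields.YangMills.Theorems.SandwichVariancePinchingCeilingRemainder

/-!
# Route `SandwichVariancePinching` — crux `QuadraticVarianceCeiling` (stmt-QuantumFields-28259):
# **the variance CEILING for a SMOOTH potential in the whitened frame** (`H₀ = 1`, `A ∈ C²`)

`ceilingWhitened_of_contDiff`: for `0 ≤ δ ≤ 1/2`, `H` symmetric, `b`, `A ∈ C²` with the Euclidean second-difference
sandwich and the centring: `gE(q²) − gE(q)² ≤ (1 + 26δ)·(2 tr H² + |b|²)`, constants independent of `n`.
STEIN PROXY (memo = evidence #4 on 28259): with `u = Hx + b` the affine score `G = ∂_uA − trH` IS `q − trH + R`,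
`R = ∂_uA − q`, so `q − E q = G − (R − E R)` and, pointwise, `(g − r)² ≤ (1+t)g² + (1+t⁻¹)r²`.  Inputs:
`∫G²e^{−A} ≤ τZ + (1+δ)(S₂ + |b|²Z)`, `S₂ ≤ (1−δ)⁻¹τZ` (`…CeilingDefect`), and the remainder variance
`≤ (1−δ)⁻¹(2δ²(S₂+|b|²Z) + 2(1−δ)⁻¹δ²τZ)Z` (`…CeilingRemainder`); then `t = δ` (`t → 0` when `δ = 0`).

HONEST SCOPE.  Free-hands work of the LEAD seat of crux stmt-QuantumFields-22884 (cell ym-idea-1); smooth whitened case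
only (continuous `A`, general `H₀`: `…CeilingMollification`, `…CeilingWhitening`); nothing here proves
`QuadraticCovarianceComparison` (26240) by itself, the `LogConcaveChart` thesis, rung R2a or any summit statement;
the Yang–Mills mass gap is NOT proved by any of this.
-/

noncomputable section

namespace Summit.QuantumFields.YangMills.Theorems.SandwichVariancePinching

open MeasureTheory Real Filter Topology
open Summit.QuantumFields.YangMills.Cruxes.TransportCovarianceTransfer

variable {n : ℕ}

/-- Pointwise splitting inequality `(g − r)² ≤ (1+t)g² + (1+t⁻¹)r²` for `t > 0`. [folklore] -/
theorem sq_sub_le_split {t : ℝ} (ht : 0 < t) (g r : ℝ) : (g - r) ^ 2 ≤ (1 + t) * g ^ 2 + (1 + t⁻¹) * r ^ 2 := by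
  have key : 0 ≤ t * g ^ 2 + t⁻¹ * r ^ 2 + 2 * g * r := by
    have : t * g ^ 2 + t⁻¹ * r ^ 2 + 2 * g * r = t⁻¹ * (t * g + r) ^ 2 := by
      field_simp; ring
    rw [this]; positivity
  nlinarith

/-- **THE VARIANCE CEILING FOR A SMOOTH POTENTIAL IN THE WHITENED FRAME** (`C = 26`, `δ ≤ 1/2`). [folklore] -/
theorem ceilingWhitened_of_contDiff {δ : ℝ} (hδ : 0 ≤ δ) (hδ2 : δ ≤ 1 / 2)
    (H : Matrix (Fin n) (Fin n) ℝ) (b : Fin n → ℝ) {A : (Fin n → ℝ) → ℝ} (hH : H.IsSymm)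
    (hA : ContDiff ℝ 2 A)
    (hsw : ∀ x h : Fin n → ℝ, (1 - δ) * (h ⬝ᵥ h) ≤ A (x + h) + A (x - h) - 2 * A x ∧
      A (x + h) + A (x - h) - 2 * A x ≤ (1 + δ) * (h ⬝ᵥ h))
    (hcent : ∀ i : Fin n, ∫ x, x i * exp (-A x) = 0) :
    (∫ x, (x ⬝ᵥ H.mulVec x + b ⬝ᵥ x) * (x ⬝ᵥ H.mulVec x + b ⬝ᵥ x) * exp (-A x)) / (∫ x, exp (-A x)) -
        (∫ x, (x ⬝ᵥ H.mulVec x + b ⬝ᵥ x) * exp (-A x)) / (∫ x, exp (-A x)) *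
          ((∫ x, (x ⬝ᵥ H.mulVec x + b ⬝ᵥ x) * exp (-A x)) / (∫ x, exp (-A x))) ≤
      (1 + 26 * δ) * (2 * (H * H).trace + b ⬝ᵥ b) := by
  have hδ1 : δ < 1 := by linarith
  have hAc : Continuous A := hA.continuous
  obtain ⟨C₀, κ, _, hκ, hlb⟩ := exists_quadratic_lower_of_sandwich hAc hδ1 hsw
  have hZint : Integrable fun x => exp (-A x) := by
    have := integrable_mul_exp_neg_of_growth hAc continuous_const hκ (by norm_num : 0 ≤ 8) hlb
      (w := fun _ => (1:ℝ)) (D := 1) (fun x => by simp)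
    simpa using this
  have hZ : 0 < ∫ x, exp (-A x) := integral_exp_pos hZint
  set Z : ℝ := ∫ x, exp (-A x) with hZdef
  set q : (Fin n → ℝ) → ℝ := fun x => x ⬝ᵥ H.mulVec x + b ⬝ᵥ x with hqdef
  have hqc1 : ContDiff ℝ 1 q := contDiff_quadObs H b
  have hqc : Continuous q := hqc1.continuous
  obtain ⟨Dq, Dq', hDq0, _, hqb, _⟩ := quadObs_growth hH b
  set τ : ℝ := (H * H).trace with hτdef
  have hτ0 : 0 ≤ τ := by rw [hτdef, trace_mul_self_of_isSymm hH]; positivity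
  have hbb : 0 ≤ b ⬝ᵥ b := by simpa using dotProduct_self_star_nonneg b
  set S2 : ℝ := ∫ x, (H.mulVec x ⬝ᵥ H.mulVec x) * exp (-A x) with hS2def
  -- the three inputs
  have hS2le : S2 ≤ (1 - δ)⁻¹ * τ * Z := integral_mulVec_sq_le hA hδ1 hsw hcent hH
  have hX : ∫ x, (fderiv ℝ A x (H.mulVec x + b) - H.trace) ^ 2 * exp (-A x) ≤
      τ * Z + (1 + δ) * (S2 + (b ⬝ᵥ b) * Z) := score_sq_le hA hδ hδ1 hsw hcent hH b
  set R : (Fin n → ℝ) → ℝ := fun x => fderiv ℝ A x (H.mulVec x + b) - q x with hRdef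
  have hVR : (∫ x, R x ^ 2 * exp (-A x)) * Z - (∫ x, R x * exp (-A x)) ^ 2 ≤
      (1 - δ)⁻¹ * (2 * δ ^ 2 * (S2 + (b ⬝ᵥ b) * Z) + 2 * ((1 - δ)⁻¹ * (δ ^ 2 * τ) * Z)) * Z :=
    remainder_variance_le hA hδ hδ1 hsw hcent hH b
  -- growth / integrability
  have hRc : Continuous R := ((contDiff_fderiv_affine hA H b).sub hqc1).continuous
  obtain ⟨D₁, hD₁0, hD₁⟩ := exists_abs_fderiv_affine_le hA hδ hsw H b
  have hRb : ∀ x, |R x| ≤ (D₁ + Dq) * (1 + ‖x‖) ^ 3 := fun x => by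
    calc |R x| ≤ |fderiv ℝ A x (H.mulVec x + b)| + |q x| := abs_sub _ _
      _ ≤ D₁ * (1 + ‖x‖) ^ 3 + Dq * (1 + ‖x‖) ^ 3 := add_le_add (hD₁ x) (hqb x)
      _ = (D₁ + Dq) * (1 + ‖x‖) ^ 3 := by ring
  have hIq : Integrable fun x => q x * exp (-A x) :=
    integrable_mul_exp_neg_of_growth hAc hqc hκ (by norm_num) hlb hqb
  have hIqq : Integrable fun x => q x * q x * exp (-A x) :=
    integrable_mul_exp_neg_of_growth hAc (hqc.mul hqc) hκ (by norm_num : 3 + 3 ≤ 8) hlb (abs_mul_le_growth hqb hqb)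
  have hIRi : Integrable fun x => R x * exp (-A x) :=
    integrable_mul_exp_neg_of_growth hAc hRc hκ (by norm_num) hlb hRb
  have hIRRi : Integrable fun x => R x ^ 2 * exp (-A x) := by
    have := abs_mul_le_growth hRb hRb
    refine integrable_mul_exp_neg_of_growth hAc (hRc.pow 2) hκ (by norm_num : 3 + 3 ≤ 8) hlb
      (D := (D₁ + Dq) * (D₁ + Dq)) (fun x => ?_)
    rw [sq]; exact this x
  have hIdA : Integrable fun x => fderiv ℝ A x (H.mulVec x + b) * exp (-A x) :=
    integrable_mul_exp_neg_of_growth hAc (contDiff_fderiv_affine hA H b).continuous hκ (by norm_num) hlb hD₁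
  -- `∫ ∂_uA e^{−A} = trH · Z` (score identity with `F ≡ 1`)
  have hIdAval : ∫ x, fderiv ℝ A x (H.mulVec x + b) * exp (-A x) = H.trace * Z := by
    have h1 := integral_mul_fderiv_affine_mul_exp_neg hA hδ hδ1 hsw H b
      (F := fun _ => (1:ℝ)) contDiff_const (DF := 1) (DF' := 0)
      (fun x => by rw [abs_one, one_mul]; exact one_le_pow₀ (by linarith [norm_nonneg x]))
      (fun x j => by simp)
    simp only [one_mul, fderiv_fun_const, Pi.zero_apply, zero_apply, zero_add, mul_one] at h1
    rw [h1, integral_const_mul]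
  set Iq : ℝ := ∫ x, q x * exp (-A x) with hIqdef
  set Iqq : ℝ := ∫ x, q x * q x * exp (-A x) with hIqqdef
  set IR : ℝ := ∫ x, R x * exp (-A x) with hIRdef
  set IRR : ℝ := ∫ x, R x ^ 2 * exp (-A x) with hIRRdef
  have hmean : Iq = H.trace * Z - IR := by
    have e1 : (fun x => R x * exp (-A x)) = fun x => fderiv ℝ A x (H.mulVec x + b) * exp (-A x) - q x * exp (-A x) := by
      funext x; simp only [hRdef]; ring
    rw [hIRdef, e1, integral_sub hIdA hIq, hIdAval]
    ring
  -- the `t`-inequality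
  have hsplit : ∀ t : ℝ, 0 < t →
      Iqq - Iq ^ 2 / Z ≤ (1 + t) * (τ * Z + (1 + δ) * (S2 + (b ⬝ᵥ b) * Z)) +
        (1 + t⁻¹) * ((IRR * Z - IR ^ 2) / Z) := by
    intro t ht
    have hVq : ∫ x, (q x - Iq / Z) ^ 2 * exp (-A x) = Iqq - Iq ^ 2 / Z := by
      have e : (fun x => (q x - Iq / Z) ^ 2 * exp (-A x)) = fun x =>
          q x * q x * exp (-A x) - (2 * (Iq / Z)) * (q x * exp (-A x)) + (Iq / Z) ^ 2 * exp (-A x) := by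
        funext x; ring
      have hI1 : Integrable fun x => q x * q x * exp (-A x) - (2 * (Iq / Z)) * (q x * exp (-A x)) :=
        hIqq.sub (hIq.const_mul _)
      rw [e, integral_add hI1 (hZint.const_mul _), integral_sub hIqq (hIq.const_mul _), integral_const_mul,
        integral_const_mul, ← hIqqdef, ← hIqdef, ← hZdef]
      field_simp; ring
    have hVRi : ∫ x, (R x - IR / Z) ^ 2 * exp (-A x) = (IRR * Z - IR ^ 2) / Z := by
      have e : (fun x => (R x - IR / Z) ^ 2 * exp (-A x)) = fun x =>
          R x ^ 2 * exp (-A x) - (2 * (IR / Z)) * (R x * exp (-A x)) + (IR / Z) ^ 2 * exp (-A x) := by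
        funext x; ring
      have hI1 : Integrable fun x => R x ^ 2 * exp (-A x) - (2 * (IR / Z)) * (R x * exp (-A x)) :=
        hIRRi.sub (hIRi.const_mul _)
      rw [e, integral_add hI1 (hZint.const_mul _), integral_sub hIRRi (hIRi.const_mul _), integral_const_mul,
        integral_const_mul, ← hIRRdef, ← hIRdef, ← hZdef]
      field_simp; ring
    have hpt : ∀ x, (q x - Iq / Z) ^ 2 * exp (-A x) ≤
        (1 + t) * ((fderiv ℝ A x (H.mulVec x + b) - H.trace) ^ 2 * exp (-A x)) +
          (1 + t⁻¹) * ((R x - IR / Z) ^ 2 * exp (-A x)) := by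
      intro x
      have hid : q x - Iq / Z = (fderiv ℝ A x (H.mulVec x + b) - H.trace) - (R x - IR / Z) := by
        simp only [hRdef]
        rw [hmean]
        field_simp
        ring
      rw [hid]
      have he : 0 ≤ exp (-A x) := (exp_pos _).le
      have hs := mul_le_mul_of_nonneg_right (sq_sub_le_split ht (fderiv ℝ A x (H.mulVec x + b) - H.trace)
        (R x - IR / Z)) he
      nlinarith only [hs]
    have hGc : Continuous fun x => fderiv ℝ A x (H.mulVec x + b) - H.trace :=
      (contDiff_fderiv_affine hA H b).continuous.sub continuous_const
    have hGb : ∀ x, |fderiv ℝ A x (H.mulVec x + b) - H.trace| ≤ (D₁ + |H.trace|) * (1 + ‖x‖) ^ 3 := fun x => by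
      have h2 : (1:ℝ) ≤ (1 + ‖x‖) ^ 3 := one_le_pow₀ (by linarith [norm_nonneg x])
      calc |fderiv ℝ A x (H.mulVec x + b) - H.trace| ≤ |fderiv ℝ A x (H.mulVec x + b)| + |H.trace| := abs_sub _ _
        _ ≤ D₁ * (1 + ‖x‖) ^ 3 + |H.trace| * (1 + ‖x‖) ^ 3 :=
            add_le_add (hD₁ x) (le_mul_of_one_le_right (abs_nonneg _) h2)
        _ = (D₁ + |H.trace|) * (1 + ‖x‖) ^ 3 := by ring
    have hI_G2 : Integrable fun x => (fderiv ℝ A x (H.mulVec x + b) - H.trace) ^ 2 * exp (-A x) := by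
      have := abs_mul_le_growth hGb hGb
      refine integrable_mul_exp_neg_of_growth hAc (hGc.pow 2) hκ (by norm_num : 3 + 3 ≤ 8) hlb
        (D := (D₁ + |H.trace|) * (D₁ + |H.trace|)) (fun x => ?_)
      rw [sq]; exact this x
    have hgen : ∀ (F : (Fin n → ℝ) → ℝ) (DF c : ℝ), Continuous F → (∀ x, |F x| ≤ DF * (1 + ‖x‖) ^ 3) →
        Integrable fun x => (F x - c) ^ 2 * exp (-A x) := by
      intro F DF c hFc hFb
      have hb' : ∀ x, |F x - c| ≤ (DF + |c|) * (1 + ‖x‖) ^ 3 := fun x => by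
        have h2 : (1:ℝ) ≤ (1 + ‖x‖) ^ 3 := one_le_pow₀ (by linarith [norm_nonneg x])
        calc |F x - c| ≤ |F x| + |c| := abs_sub _ _
          _ ≤ DF * (1 + ‖x‖) ^ 3 + |c| * (1 + ‖x‖) ^ 3 :=
              add_le_add (hFb x) (le_mul_of_one_le_right (abs_nonneg _) h2)
          _ = (DF + |c|) * (1 + ‖x‖) ^ 3 := by ring
      have := abs_mul_le_growth hb' hb'
      refine integrable_mul_exp_neg_of_growth hAc ((hFc.sub continuous_const).pow 2) hκ (by norm_num : 3 + 3 ≤ 8)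
        hlb (D := (DF + |c|) * (DF + |c|)) (fun x => ?_)
      rw [sq]; exact this x
    have hIq_c := hgen q Dq (Iq / Z) hqc hqb
    have hIR_c := hgen R (D₁ + Dq) (IR / Z) hRc hRb
    have hsum : Integrable fun x => (1 + t) * ((fderiv ℝ A x (H.mulVec x + b) - H.trace) ^ 2 * exp (-A x)) +
        (1 + t⁻¹) * ((R x - IR / Z) ^ 2 * exp (-A x)) := (hI_G2.const_mul _).add (hIR_c.const_mul _)
    have hmono := integral_mono hIq_c hsum hpt
    rw [integral_add (hI_G2.const_mul _) (hIR_c.const_mul _), integral_const_mul, integral_const_mul,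
      hVq, hVRi] at hmono
    have ht1 : 0 ≤ 1 + t := by linarith
    have := mul_le_mul_of_nonneg_left hX ht1
    linarith only [hmono, this]
  -- the numbers
  set rV : ℝ := 2 * τ + b ⬝ᵥ b with hrVdef
  have hrV0 : 0 ≤ rV := by rw [hrVdef]; positivity
  set a : ℝ := (1 - δ)⁻¹ with hadef
  have ha1 : (1 - δ) * a = 1 := mul_inv_cancel₀ (by linarith)
  have ha0 : 0 ≤ a := inv_nonneg.mpr (by linarith)
  have ha2 : a ≤ 2 := by
    rw [hadef, inv_le_comm₀ (by linarith) (by norm_num)]; linarith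
  have ha3 : a ≤ 1 + 2 * δ := by nlinarith only [ha1, ha2, hδ, ha0]
  have hY : (IRR * Z - IR ^ 2) / Z ≤ 8 * δ ^ 2 * rV * Z := by
    rw [div_le_iff₀ hZ]
    have h1 : IRR * Z - IR ^ 2 ≤ a * (2 * δ ^ 2 * (S2 + (b ⬝ᵥ b) * Z) + 2 * (a * (δ ^ 2 * τ) * Z)) * Z := hVR
    have h4 : 2 * δ ^ 2 * (S2 + (b ⬝ᵥ b) * Z) + 2 * (a * (δ ^ 2 * τ) * Z) ≤
        2 * δ ^ 2 * (a * τ * Z + (b ⬝ᵥ b) * Z) + 2 * (a * (δ ^ 2 * τ) * Z) := by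
      nlinarith only [mul_le_mul_of_nonneg_left hS2le (sq_nonneg δ)]
    have h5 : 2 * δ ^ 2 * (a * τ * Z + (b ⬝ᵥ b) * Z) + 2 * (a * (δ ^ 2 * τ) * Z) ≤ 4 * δ ^ 2 * rV * Z := by
      rw [hrVdef]
      have p1 : 0 ≤ δ ^ 2 * τ * Z := by positivity
      have p2 : 0 ≤ δ ^ 2 * (b ⬝ᵥ b) * Z := by positivity
      nlinarith only [mul_le_mul_of_nonneg_left ha2 p1, mul_le_mul_of_nonneg_left ha2 p2, p1, p2]
    have h3 : a * (2 * δ ^ 2 * (S2 + (b ⬝ᵥ b) * Z) + 2 * (a * (δ ^ 2 * τ) * Z)) ≤ 8 * δ ^ 2 * rV * Z := by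
      calc a * (2 * δ ^ 2 * (S2 + (b ⬝ᵥ b) * Z) + 2 * (a * (δ ^ 2 * τ) * Z))
          ≤ a * (4 * δ ^ 2 * rV * Z) := mul_le_mul_of_nonneg_left (h4.trans h5) ha0
        _ ≤ 2 * (4 * δ ^ 2 * rV * Z) := mul_le_mul_of_nonneg_right ha2 (by positivity)
        _ = 8 * δ ^ 2 * rV * Z := by ring
    exact h1.trans (mul_le_mul_of_nonneg_right h3 hZ.le)
  have hXle : τ * Z + (1 + δ) * (S2 + (b ⬝ᵥ b) * Z) ≤ (τ + (1 + δ) * (a * τ + b ⬝ᵥ b)) * Z := by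
    have h1δ : 0 ≤ 1 + δ := by linarith
    nlinarith only [mul_le_mul_of_nonneg_left hS2le h1δ]
  have hfrac : Iqq / Z - Iq / Z * (Iq / Z) = (Iqq - Iq ^ 2 / Z) / Z := by field_simp
  rw [hfrac, div_le_iff₀ hZ]
  rcases hδ.lt_or_eq with hpos | hzero
  · have h := hsplit δ hpos
    have hcoef : (1 + δ) * (τ + (1 + δ) * (a * τ + b ⬝ᵥ b)) ≤ (1 + 4 * δ) * rV := by
      rw [hrVdef]
      have hd2 : δ ^ 2 ≤ δ / 2 := by nlinarith only [hδ, hδ2]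
      have hd3 : δ ^ 3 ≤ δ / 4 := by nlinarith only [hδ, hδ2, hd2]
      have haτ : (1 + δ) * (1 + δ) * (a * τ) ≤ (1 + δ) * (1 + δ) * ((1 + 2 * δ) * τ) :=
        mul_le_mul_of_nonneg_left (mul_le_mul_of_nonneg_right ha3 hτ0) (by positivity)
      have q1 := mul_le_mul_of_nonneg_right hd2 hτ0
      have q2 := mul_le_mul_of_nonneg_right hd3 hτ0
      have q3 := mul_le_mul_of_nonneg_right hd2 hbb
      nlinarith only [haτ, q1, q2, q3, mul_nonneg hδ hτ0, mul_nonneg hδ hbb, hτ0, hbb, hδ]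
    have hδinv : (1 + δ⁻¹) * (8 * δ ^ 2 * rV * Z) = 8 * (δ ^ 2 + δ) * rV * Z := by
      field_simp
    have h1 : (1 + δ) * (τ * Z + (1 + δ) * (S2 + (b ⬝ᵥ b) * Z)) ≤ (1 + 4 * δ) * rV * Z := by
      have := mul_le_mul_of_nonneg_left hXle (by linarith : (0:ℝ) ≤ 1 + δ)
      nlinarith only [this, mul_le_mul_of_nonneg_right hcoef hZ.le]
    have h2 : (1 + δ⁻¹) * ((IRR * Z - IR ^ 2) / Z) ≤ 8 * (δ ^ 2 + δ) * rV * Z := by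
      rw [← hδinv]
      exact mul_le_mul_of_nonneg_left hY (by positivity)
    have hd2 : δ ^ 2 ≤ δ / 2 := by nlinarith only [hδ, hδ2]
    have hrZ : 0 ≤ rV * Z := mul_nonneg hrV0 hZ.le
    nlinarith only [h, h1, h2, hrZ, mul_le_mul_of_nonneg_right hd2 hrZ, hδ]
  · subst hzero
    have hY0 : (IRR * Z - IR ^ 2) / Z ≤ 0 := by simpa using hY
    have ha' : a = 1 := by rw [hadef]; norm_num
    have hX0 : τ * Z + (1 + 0) * (S2 + (b ⬝ᵥ b) * Z) ≤ rV * Z := by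
      have := hXle
      rw [ha'] at this; rw [hrVdef]; linarith only [this]
    refine le_of_forall_pos_le_add fun ε hε => ?_
    have hZ1 : 0 < rV * Z + 1 := by positivity
    have h := hsplit (ε / (rV * Z + 1)) (by positivity)
    have h2 : (1 + (ε / (rV * Z + 1))⁻¹) * ((IRR * Z - IR ^ 2) / Z) ≤ 0 :=
      mul_nonpos_of_nonneg_of_nonpos (by positivity) hY0
    have h3 : (1 + ε / (rV * Z + 1)) * (τ * Z + (1 + 0) * (S2 + (b ⬝ᵥ b) * Z)) ≤
        (1 + ε / (rV * Z + 1)) * (rV * Z) := mul_le_mul_of_nonneg_left hX0 (by positivity)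
    have h4 : ε / (rV * Z + 1) * (rV * Z) ≤ ε := by
      rw [div_mul_eq_mul_div, div_le_iff₀ hZ1]; nlinarith only [mul_nonneg hrV0 hZ.le, hε]
    have e0 : (1 + 26 * (0:ℝ)) * rV * Z + ε = rV * Z + ε := by ring
    rw [e0]
    nlinarith only [h, h2, h3, h4]

end Summit.QuantumFields.YangMills.Theorems.SandwichVariancePinching

end
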